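import Summits.HubbardSuperconductivity.HubbardSuperconductivity.Theorems.AnisotropyChordTransferFibre3G2OneLoop
import Summits.HubbardSuperconductivity.HubbardSuperconductivity.Theorems.AnisotropyChordTransferFibre3GradSNormClosed

/-!
# Route `AnisotropyChord` / H0 rotor rung: the (KT-1″) ROW ASSEMBLY — brackets on the named one-loop objects ⇒ `TrialGapAbs`

Piece A (stmt-HubbardSuperconductivity-23918) of the GM₃ chain needs `TrialGapAbs L Δ c` (`c·U ≤ N₁` at the ground profile,
`U = 3V²T⁺`).  By the PROVED identity layer (`n1Identity_holds`: `N₁ = −(ε₁ + T⁺ − 3λ₂)B − (ε₁/2)G₂ + B_C`;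
`g2OneLoopForm_holds`: `G₂ = T⁺‖Π⁰‖² + 12Δ f(x̂)² A(x̂)`) the crux is pure INTERVAL ARITHMETIC once the five named reals
`B = Bterm`, `‖Π⁰‖² = PiNormSq`, `A(x̂) = Axhat`, `B_C = BCterm`, `T⁺ = Tplus` are bracketed at the ground profile —
which is what both producers deliver: the kernel FIN evaluator (p3, λ-cells, per `L`) and the analytic Level-2 rows
(theory PartN41-B brackets, p2's L-uniform B1 bracket, L ≥ L₀).  This file is that shared last step:
* ★ `trialGapN1_ge_of_brackets`: `B ≤ B⁺ ≤ 0`, `‖Π⁰‖² ≤ P⁺`, `A(x̂) ≤ A⁺`, `B_C ≥ B_C⁻`, `T⁻ ≤ T⁺ ≤ T⁺⁺`, `ε₁ + T⁻ − 3λ₂ ≥ 0`, `0 ≤ Δ ≤ 1`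
  ⇒ `N₁ ≥ (ε₁ + T⁻ − 3λ₂)(−B⁺) − (ε₁/2)(T⁺⁺P⁺ + 12Δ f(x̂)²A⁺) + B_C⁻`;
* ★ `trialGap_pointwise_of_brackets`: with moreover `0 ≤ c` and `c·3V²·T⁺⁺ ≤` that lower bound ⇒ `c·Uunit ≤ trialGapN1`;
* ★ `trialGapAbs_of_brackets`: the `∀ ground profile` form ⇒ `TrialGapAbs L Δ c`.
Prover seat `hubbard-h0-rotor-p1` g26 (route lead; per-row assembly); helper for stmt-HubbardSuperconductivity-23918 (`--supports`, helper class).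
WHAT THIS IS NOT: nothing here proves superconductivity in the Hubbard model, nor the crux itself — it reduces (KT-1″) to
numerical brackets of five named one-loop quantities.  Tree imports only; no new definitions; no sorry, no axioms.
-/

set_option linter.dupNamespace false
set_option autoImplicit false

noncomputable section

open scoped BigOperators

namespace Summit.HubbardSuperconductivity.HubbardSuperconductivity.Theorems.AnisotropyChord.Transfer.Fibre3

namespace KT1Assembly

variable (L : ℕ) [NeZero L]

/-- ★ the (KT-1″) lower bound from brackets on `B`, `‖Π⁰‖²`, `A(x̂)`, `B_C`, `T⁺` at a ground profile. [folklore] -/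
theorem trialGapN1_ge_of_brackets (hL : 4 ≤ L) {Δ lam2 : ℝ} (hΔ0 : 0 ≤ Δ) (hΔ1 : Δ ≤ 1) {f : Tor L → ℝ}
    (hf : IsGroundTwoMagnon L Δ lam2 f) {Bhi Phi Ahi BClo Tlo Thi : ℝ}
    (hB : Bterm L f ≤ Bhi) (hBhi : Bhi ≤ 0) (hP : PiNormSq L f ≤ Phi) (hA : Axhat L f ≤ Ahi)
    (hBC : BClo ≤ BCterm L Δ lam2 f) (hTlo : Tlo ≤ Tplus L Δ f) (hThi : Tplus L Δ f ≤ Thi)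
    (hκ : 0 ≤ eps1 L + Tlo - 3 * lam2) :
    (eps1 L + Tlo - 3 * lam2) * (-Bhi) - eps1 L / 2 * (Thi * Phi + 12 * Δ * f (K1 L) ^ 2 * Ahi) + BClo
      ≤ trialGapN1 L Δ f := by
  have hL2 : 2 ≤ L := by omega
  have heven : ∀ r : Tor L, f (-r) = f r := hf.2.1
  have hswap : ∀ r : Tor L, f (r.2, r.1) = f r := ground_swap L hL2 hf
  have hN1 := n1Identity_holds L Δ lam2 f hf.1
  have hG2 := g2OneLoopForm_holds L (by omega) Δ lam2 f hf.1 heven hswap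
  have hT0 : 0 ≤ Tplus L Δ f := Tplus_nonneg L hL2 hΔ1 hf
  have hε : 0 < eps1 L := eps1_pos L (by omega)
  have hP0 : 0 ≤ PiNormSq L f := by unfold PiNormSq; positivity
  rw [hN1, hG2]
  set T := Tplus L Δ f with hT
  set B := Bterm L f
  set P := PiNormSq L f
  set A := Axhat L f
  -- the `B` term
  have h1 : (eps1 L + Tlo - 3 * lam2) * (-Bhi) ≤ -(eps1 L + T - 3 * lam2) * B := by
    have hκ' : eps1 L + Tlo - 3 * lam2 ≤ eps1 L + T - 3 * lam2 := by linarith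
    have hnegB : -Bhi ≤ -B := by linarith
    have hnegB0 : 0 ≤ -Bhi := by linarith
    nlinarith [mul_le_mul hκ' hnegB hnegB0 (by linarith)]
  -- the `G₂` term
  have h2 : T * P + 12 * Δ * f (K1 L) ^ 2 * A ≤ Thi * Phi + 12 * Δ * f (K1 L) ^ 2 * Ahi := by
    have hTP : T * P ≤ Thi * Phi := mul_le_mul hThi hP hP0 (by linarith)
    have hA' : 12 * Δ * f (K1 L) ^ 2 * A ≤ 12 * Δ * f (K1 L) ^ 2 * Ahi :=
      mul_le_mul_of_nonneg_left hA (by positivity)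
    linarith
  have h2' : -(eps1 L / 2 * (Thi * Phi + 12 * Δ * f (K1 L) ^ 2 * Ahi))
      ≤ -(eps1 L / 2 * (T * P + 12 * Δ * f (K1 L) ^ 2 * A)) := by
    have := mul_le_mul_of_nonneg_left h2 (show 0 ≤ eps1 L / 2 by positivity)
    linarith
  linarith

/-- ★ pointwise (KT-1″): with `0 ≤ c` and `c·3V²·T⁺⁺ ≤` the bracket lower bound, `c·U ≤ N₁`. [folklore] -/
theorem trialGap_pointwise_of_brackets (hL : 4 ≤ L) {Δ lam2 : ℝ} (hΔ0 : 0 ≤ Δ) (hΔ1 : Δ ≤ 1) {f : Tor L → ℝ}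
    (hf : IsGroundTwoMagnon L Δ lam2 f) {c Bhi Phi Ahi BClo Tlo Thi : ℝ} (hc : 0 ≤ c)
    (hB : Bterm L f ≤ Bhi) (hBhi : Bhi ≤ 0) (hP : PiNormSq L f ≤ Phi) (hA : Axhat L f ≤ Ahi)
    (hBC : BClo ≤ BCterm L Δ lam2 f) (hTlo : Tlo ≤ Tplus L Δ f) (hThi : Tplus L Δ f ≤ Thi)
    (hκ : 0 ≤ eps1 L + Tlo - 3 * lam2)
    (hineq : c * (3 * ((L : ℝ) ^ 2) ^ 2 * Thi)
      ≤ (eps1 L + Tlo - 3 * lam2) * (-Bhi) - eps1 L / 2 * (Thi * Phi + 12 * Δ * f (K1 L) ^ 2 * Ahi) + BClo) :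
    c * Uunit L Δ f ≤ trialGapN1 L Δ f := by
  have h := trialGapN1_ge_of_brackets L hL hΔ0 hΔ1 hf hB hBhi hP hA hBC hTlo hThi hκ
  have hU : c * Uunit L Δ f ≤ c * (3 * ((L : ℝ) ^ 2) ^ 2 * Thi) := by
    unfold Uunit
    apply mul_le_mul_of_nonneg_left _ hc
    exact mul_le_mul_of_nonneg_left hThi (by positivity)
  linarith

/-- ★ `TrialGapAbs L Δ c` from brackets supplied for every ground profile (the unique one, `ground_unique`). [folklore] -/
theorem trialGapAbs_of_brackets (hL : 4 ≤ L) {Δ c : ℝ} (hΔ0 : 0 ≤ Δ) (hΔ1 : Δ ≤ 1) (hc : 0 ≤ c)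
    (h : ∀ lam2 : ℝ, ∀ f : Tor L → ℝ, IsGroundTwoMagnon L Δ lam2 f →
      ∃ Bhi Phi Ahi BClo Tlo Thi : ℝ,
        Bterm L f ≤ Bhi ∧ Bhi ≤ 0 ∧ PiNormSq L f ≤ Phi ∧ Axhat L f ≤ Ahi ∧ BClo ≤ BCterm L Δ lam2 f ∧
        Tlo ≤ Tplus L Δ f ∧ Tplus L Δ f ≤ Thi ∧ 0 ≤ eps1 L + Tlo - 3 * lam2 ∧
        c * (3 * ((L : ℝ) ^ 2) ^ 2 * Thi)
          ≤ (eps1 L + Tlo - 3 * lam2) * (-Bhi) - eps1 L / 2 * (Thi * Phi + 12 * Δ * f (K1 L) ^ 2 * Ahi) + BClo) :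
    TrialGapAbs L Δ c := by
  intro lam2 f hf
  obtain ⟨Bhi, Phi, Ahi, BClo, Tlo, Thi, hB, hBhi, hP, hA, hBC, hTlo, hThi, hκ, hineq⟩ := h lam2 f hf
  exact trialGap_pointwise_of_brackets L hL hΔ0 hΔ1 hf hc hB hBhi hP hA hBC hTlo hThi hκ hineq

end KT1Assembly

end Summit.HubbardSuperconductivity.HubbardSuperconductivity.Theorems.AnisotropyChord.Transfer.Fibre3

end
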